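import Summits.RiemannHypothesis.RiemannHypothesis.Theses.OddSector
import Summits.RiemannHypothesis.RiemannHypothesis.Theorems.OddSectorOddNegativityOffLine
import Summits.RiemannHypothesis.RiemannHypothesis.Theorems.OddSectorOddOneSignedWindowsExistence
import Summits.RiemannHypothesis.RiemannHypothesis.Theorems.OddSectorOddOneSignedWindowsEulerLagrangeTransfer
import Literature.NumberTheory.LFunctions.WeilOddGroundState
import Summits.RiemannHypothesis.RiemannHypothesis.Theorems.OddOneSignedWindows.Negative.OddFoldRaisesEnergy
import HarnessLib

/-!
# Disproof of `OddOneSignedWindows` (stmt-RiemannHypothesis-17778, route OddSector, rank 2) — findings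

Standing disprover `refuter-cdisprove-stmt-RiemannHypothesis-17778-0`, cycle 1 (2026-08-17).
Everything below is kernel-checked (no `sorry`); prose lives in docstrings only.

The crux `X := OddOneSignedWindows` (`Iff.rfl`, `crux_iff`): beyond every height `A` some window
`a ≥ A` carries an odd-sector ground state `u` of Weil's form (`IsWeilOddGroundState a u`: `L²`-limit
of an `L²`-normalised minimising sequence of smooth odd window tests) with `Im u = 0`, `Re u ≥ 0`
a.e. on `(0, a)` ("good window", `GoodWindow a`).

## Verdict of the cycle: NO KILL — and why none is available

* §2 (`not_crux_of_floor_of_not_rh`, `floor_of_not_crux`): with the two RH-free items of the route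
  (`OddNegativityOffLine` is PROVED in tree, `OddBartaFloor` open) the logic is
  `OddBartaFloor → (X ↔ RH-or-better)`: `OddBartaFloor ∧ ¬RH → ¬X`, and `¬X → OddBartaFloor`
  (vacuously). So an unconditional `¬X` would hand the route its floor for free and is believed
  FALSE under RH (good windows are expected to be co-small, see Numerics); an unconditional `X`
  closes RH once the floor lands. Both directions are RH-strength; no refuter, computation or
  barrier reaches `¬X`.
* The only RH-free, finitely falsifiable content is the MECHANISM by which one-signed odd bottom
  states could be produced. The one mechanism in the tree (it proved `OddArchAnchor` and covers the
  full form at windows `a ≤ (log 2)/2`) is the antisymmetric Beurling–Deny FOLD. §4 records the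
  cycle's main result, LANDED as `Theorems/OddOneSignedWindows/Negative/OddFold{Pointwise,Increments,
  RaisesEnergy}.lean`: **at every window `a > (log 2)/2` folding can STRICTLY RAISE `Re Q`**
  (`not_oddFoldContraction`, `exists_oddFold_weilQuadratic_lt`): explicit normalised odd tests
  `g = c(g₁ − g₂)`, `h = c(g₁ + g₂)` on the prime-2 reflection antidiagonal `x + s = log 2`,
  `|h| = |g|`, `h ≥ 0` real on `(0,∞)`, fold-dominated increments, archimedean energy of `h` ≤
  that of `g`, yet `Re Q(g) < Re Q(h)`; the gap is the reflection atom `+8 Λ(2) 2^{-1/2} ‖φ‖₂²`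
  against `O(‖φ‖₁²)` from pole form, translations and the archimedean density. Hence the odd
  block is NOT Markovian/positivity-improving from `a = (log 2)/2` on, and every proof of `X` must
  be QUANTITATIVE in `Λ(n) n^{-1/2}` versus the archimedean glue `ρ` (this is exactly where the
  three ideator cards — log-coercive origin layer, theta-envelope antitone, resonance transport —
  put their RH-free stubs; none of them uses the fold).

## Load-bearing clauses (§3, mutation table — every single-clause mutation is a THEOREM or `↔`/`→ X`)

| mutation of `X` | status | theorem |
|---|---|---|
| drop the sign clause (`Im u = 0 ∧ 0 ≤ Re u`) | THEOREM (tree) | `withoutSign_holds` (`exists_isWeilOddGroundState_unbounded`, p142733) |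
| keep `Im u = 0`, drop `0 ≤ Re u` | THEOREM (tree) | `withoutNonneg_holds` (`exists_isWeilOddGroundState_real_unbounded`, p144638) |
| keep `0 ≤ Re u`, drop `Im u = 0` | THEOREM | `withoutReality_holds` (junk `u = I·v`, rattack's finding re-derived) |
| drop "minimising" (any normalised odd window test as `u`) | THEOREM | `withoutMinimising_holds` (explicit odd bump) |
| sign clause on the WHOLE window `(-a, a)` | FALSE | `not_fullWindow_oneSigned` (odd ⇒ `u = 0` a.e.) |
| `∃ a ≥ A` strengthened to `∀ a ≥ A` / to every `a > 0` | `→ X`; believed FALSE | `crux_of_allLargeWindows`; fails at `a = log q` (2001 §10 cusp; prover v2 graded mesh: bottom odd state `< 0` on `(0, 4e-5)` at `a = log 2`, hole half-width in `a` ≈ 3–5e-5) — no Lean proof (needs origin asymptotics of the odd Euler–Lagrange equation + a certified non-zero edge value) |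
| windows restricted to `a ≤ (log 2)/2` | TRUE in substance | fold mechanism (`OddArchAnchor` proof + pole form), see §4 docstring; not landed (positive, provers') |

So `X` is RIGID: all content sits in the conjunction "minimising ∧ real ∧ non-negative on the
HALF-window", on an UNBOUNDED window set; each piece alone is a theorem.

## Numerics used (other seats', not re-run; all consistent, none can touch `X`)

refuter-rattack c1 (`deccheck.py`), ideator-1 (`num/oddsec*.py`), prover-0 (mpmath, kit j023127,
`a ≤ 1.3`, `x = e^{2a} ≤ 13.5`): lowest odd Ritz vector ONE-SIGNED in the bulk at every sampled
window, single hump at `t ≈ 0.22`, `ψ′(0⁺)/max ≈ 7–10`, edge value down to `2e-27`, overlap with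
the normalised odd theta vector `0.980 (a=0.5) ↑ 0.9994 (a=1.3)`, odd bottom `7.3e-2 … 1.4e-55`;
prover-1 v2 graded mesh: the a.e. clause FAILS exactly at `a = log 2` inside `(0.55, 0.8)` (origin
cusp, `L²`-mass `2.6e-12`) and holds elsewhere there. Float Galerkin is at its floor beyond
`x ≈ 13` (near-null cluster of ≈ `2x` states below `poly(x) e^{-πx}`), so kill criterion (k2) of the
route cannot be fired numerically at larger `a` without ≥ 300-digit certified arithmetic.
`ledger negatives --problem RiemannHypothesis`: 1 unrelated entry (LaplaceLoophole). Barrier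
catalogue `Literature/Barriers/RiemannHypothesis/`: no entry bites an RH-implied-or-stronger
statement; the route's own barrier notes BN1 (odd overlap–energy) and BN3 (edge-scale matching)
constrain LINES, not `X`.

## Targets
None (no line picked; payload.targets = []). When a line registers stubs, the fold obstruction of
§4 is the first test: any stub asserting an energy-non-increasing positivity-restoring operation on
odd window tests at a window `a > (log 2)/2` is refuted by `exists_oddFold_weilQuadratic_lt`.
-/

noncomputable section

-- `Summit.RiemannHypothesis.RiemannHypothesis.…` repeats the summit name by design (D-0017 layout).
set_option linter.dupNamespace false

namespace Summit.RiemannHypothesis.RiemannHypothesis.Cruxes.OddOneSignedWindows.Disproof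

open Filter Set MeasureTheory
open scoped Topology
open Literature.NumberTheory.LFunctions
open Summit.RiemannHypothesis.RiemannHypothesis.Theses.OddSector
open Summit.RiemannHypothesis.RiemannHypothesis.Theorems (oddNegativityOffLine_proof)
open Summit.RiemannHypothesis.RiemannHypothesis.Theorems.OddSector
  (exists_isWeilOddGroundState_unbounded exists_isWeilOddGroundState_real_unbounded)

/-! ## 1. Vocabulary -/

/-- The sign clause: `u` is real and `≥ 0` a.e. on the right half-window `(0, a)`. -/
def OneSigned (a : ℝ) (u : ℝ → ℂ) : Prop :=
  ∀ᵐ t : ℝ, t ∈ Ioo 0 a → (u t).im = 0 ∧ 0 ≤ (u t).re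

/-- A GOOD WINDOW: one carrying a one-signed odd-sector ground state. -/
def GoodWindow (a : ℝ) : Prop :=
  ∃ u : ℝ → ℂ, IsWeilOddGroundState a u ∧ OneSigned a u

/-- The crux, definitionally: good windows beyond every height. -/
theorem crux_iff : OddOneSignedWindows ↔ ∀ A : ℝ, ∃ a : ℝ, A ≤ a ∧ GoodWindow a := Iff.rfl

/-- Equivalently: good windows are FREQUENT at `+∞`. -/
theorem crux_iff_frequently : OddOneSignedWindows ↔ ∃ᶠ a in atTop, GoodWindow a := by
  rw [crux_iff, frequently_atTop]

/-- A good window is a positive window (the ground-state predicate forces `0 < a`). -/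
theorem GoodWindow.pos {a : ℝ} (h : GoodWindow a) : 0 < a := by
  obtain ⟨u, hu, -⟩ := h
  exact hu.pos

/-! ## 2. Logical status: both `X` and `¬X` are RH-strength -/

/-- **`¬X` from `¬RH` and the floor.** With `OddNegativityOffLine` PROVED
(`oddNegativityOffLine_proof`), the route's deciding theorem reads `OddBartaFloor → X → RH`; so
under `¬RH` the (RH-free, open) odd Barta floor refutes the crux. A disprover therefore cannot hope
for more than `OddBartaFloor ∧ ¬RH`. -/
theorem not_crux_of_floor_of_not_rh (hB : OddBartaFloor) (hRH : ¬ _root_.RiemannHypothesis) :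
    ¬ OddOneSignedWindows :=
  fun hX ↦ hRH (closes hB hX oddNegativityOffLine_proof)

/-- **`¬X` proves the floor (vacuously).** If good windows are eventually absent, `OddBartaFloor`
holds with `e ≡ 0`: its hypothesis is never met beyond the last good window. So any refutation of
the crux kills the route by making its rank-3 item trivially true and its rank-2 item false. -/
theorem floor_of_not_crux (h : ¬ OddOneSignedWindows) : OddBartaFloor := by
  rw [crux_iff] at h
  push Not at h
  obtain ⟨A, hA⟩ := h
  exact ⟨fun _ ↦ 0, tendsto_const_nhds, A, fun a ha hgood ↦ absurd hgood (hA a ha)⟩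

/-- Contrapositive: a refutation of the floor would PROVE the crux. -/
theorem crux_of_not_floor (h : ¬ OddBartaFloor) : OddOneSignedWindows := by
  by_contra hX
  exact h (floor_of_not_crux hX)

/-- Hence, unconditionally, `X ∨ OddBartaFloor`. -/
theorem crux_or_floor : OddOneSignedWindows ∨ OddBartaFloor := by
  by_cases h : OddOneSignedWindows
  · exact Or.inl h
  · exact Or.inr (floor_of_not_crux h)

/-! ## 3. Load-bearing clauses: the mutation table -/

/-- Mutation: the sign clause dropped. -/
def CruxWithoutSign : Prop :=
  ∀ A : ℝ, ∃ a : ℝ, A ≤ a ∧ ∃ u : ℝ → ℂ, IsWeilOddGroundState a u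

/-- **Without the sign clause the crux is a THEOREM of the tree** (odd-sector ground states exist
at every window, Bombieri 2000 Thm 3 odd sector, landed as `exists_isWeilOddGroundState`). -/
theorem withoutSign_holds : CruxWithoutSign :=
  exists_isWeilOddGroundState_unbounded

/-- Mutation: reality kept, non-negativity dropped. -/
def CruxWithoutNonneg : Prop :=
  ∀ A : ℝ, ∃ a : ℝ, A ≤ a ∧ ∃ u : ℝ → ℂ, IsWeilOddGroundState a u ∧
    ∀ᵐ t : ℝ, t ∈ Ioo 0 a → (u t).im = 0

/-- **Reality alone is a THEOREM** (real-valued odd ground states exist at every window: real and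
imaginary parts of a ground state are ground states after renormalisation, landed as
`exists_isWeilOddGroundState_real_unbounded`). So `0 ≤ Re u` carries all the content. -/
theorem withoutNonneg_holds : CruxWithoutNonneg := by
  intro A
  obtain ⟨a, ha, v, hv, hreal⟩ := exists_isWeilOddGroundState_real_unbounded A
  exact ⟨a, ha, v, hv, Eventually.of_forall fun t _ ↦ hreal t⟩

/-- Mutation: non-negativity of the real part kept, reality dropped. -/
def CruxWithoutReality : Prop :=
  ∀ A : ℝ, ∃ a : ℝ, A ≤ a ∧ ∃ u : ℝ → ℂ, IsWeilOddGroundState a u ∧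
    ∀ᵐ t : ℝ, t ∈ Ioo 0 a → 0 ≤ (u t).re

/-- **Without `Im u = 0` the sign clause is JUNK-SATISFIABLE**: `u = I·v` for a real ground state
`v` is a ground state (phase invariance) with `Re u ≡ 0 ≥ 0`. Both conjuncts of the sign clause are
needed (refuter-rattack's observation, re-derived). -/
theorem withoutReality_holds : CruxWithoutReality := by
  intro A
  obtain ⟨a, ha, v, hv, hreal⟩ := exists_isWeilOddGroundState_real_unbounded A
  refine ⟨a, ha, fun t ↦ Complex.I * v t, hv.const_mul (by simp), Eventually.of_forall fun t _ ↦ ?_⟩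
  rw [Complex.mul_re, Complex.I_re, Complex.I_im, hreal t]
  simp

/-- Mutation: "minimising" dropped — `u` is just SOME normalised smooth odd window test (constant
sequence `gₙ = u`). -/
def CruxWithoutMinimising : Prop :=
  ∀ A : ℝ, ∃ a : ℝ, A ≤ a ∧ ∃ u : ℝ → ℂ, (MemLp u 2 ∧ ∃ g : ℕ → ℝ → ℂ,
    (∀ n, IsWeilTest (g n) ∧ tsupport (g n) ⊆ Icc (-a) a ∧ (∀ t, g n (-t) = -g n t) ∧
      ∫ t, ‖g n t‖ ^ 2 = (1 : ℝ)) ∧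
    Tendsto (fun n ↦ ∫ t, ‖g n t - u t‖ ^ 2) atTop (𝓝 0)) ∧ OneSigned a u

/-- **Without minimisation the crux is TRIVIAL**: an explicit normalised smooth odd bump, positive
on `(0, a)`, is its own "minimising sequence". (So the whole content of `X` is the conjunction
minimising ∧ real ∧ non-negative-on-the-half-window, on unboundedly many windows.) -/
theorem withoutMinimising_holds : CruxWithoutMinimising := by
  intro A
  set a : ℝ := max A 1 with ha
  have ha1 : 1 ≤ a := le_max_right _ _
  -- a bump at `a/2` with radii `a/8 < a/4`
  let φ : ContDiffBump (a / 2) := ⟨a / 8, a / 4, by positivity, by linarith⟩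
  have hOut : φ.rOut = a / 4 := rfl
  have hφs : ∀ y, φ y ≠ 0 → a / 4 < y ∧ y < 3 * a / 4 := fun y hy ↦ by
    have hy' : y ∈ Function.support (φ : ℝ → ℝ) := hy
    rw [φ.support_eq, Metric.mem_ball, Real.dist_eq, abs_lt, hOut] at hy'
    constructor <;> linarith [hy'.1, hy'.2]
  -- the odd real test `w = φ − φ(−·)` and its normalisation
  set w : ℝ → ℂ := fun x ↦ ((φ x - φ (-x) : ℝ) : ℂ) with hw
  have hwc : HasCompactSupport w := by
    refine HasCompactSupport.intro (K := Icc (-a) a) isCompact_Icc fun x hx ↦ ?_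
    rw [mem_Icc, not_and_or, not_le, not_le] at hx
    have h1 : φ x = 0 := by
      by_contra h
      have b := hφs _ h
      rcases hx with hx | hx <;> linarith
    have h2 : φ (-x) = 0 := by
      by_contra h
      have b := hφs _ h
      rcases hx with hx | hx <;> linarith
    simp [hw, h1, h2]
  have hwt : IsWeilTest w :=
    ⟨Complex.ofRealCLM.contDiff.comp (φ.contDiff.sub (φ.contDiff.comp contDiff_neg)), hwc⟩
  have hws : tsupport w ⊆ Icc (-a) a := by
    refine closure_minimal (fun x hx ↦ ?_) isClosed_Icc
    by_contra hn
    rw [mem_Icc, not_and_or, not_le, not_le] at hn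
    have h1 : φ x = 0 := by
      by_contra h
      have b := hφs _ h
      rcases hn with hn | hn <;> linarith
    have h2 : φ (-x) = 0 := by
      by_contra h
      have b := hφs _ h
      rcases hn with hn | hn <;> linarith
    exact hx (by simp [hw, h1, h2])
  have hwo : ∀ t, w (-t) = -w t := fun t ↦ by
    simp only [hw, neg_neg]
    push_cast
    ring
  -- `w ≠ 0`, so it can be normalised
  set N : ℝ := ∫ t, ‖w t‖ ^ 2 with hN
  have hN0 : 0 ≤ N := integral_nonneg fun t ↦ by positivity
  have hNne : N ≠ 0 := by
    intro h0
    have hw0 := hwt.eq_zero_of_integral_norm_sq_eq_zero h0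
    have h1 : φ (a / 2) = 1 := φ.one_of_mem_closedBall (Metric.mem_closedBall_self (by positivity))
    have h2 : φ (-(a / 2)) = 0 := by
      by_contra h
      have b := hφs _ h
      linarith [b.1]
    have : w (a / 2) = 0 := by rw [hw0]; rfl
    simp [hw, h1, h2] at this
  have hNpos : 0 < N := lt_of_le_of_ne hN0 (Ne.symm hNne)
  set c : ℝ := (Real.sqrt N)⁻¹ with hc
  have hcpos : 0 < c := inv_pos.2 (Real.sqrt_pos.2 hNpos)
  have hc2 : c ^ 2 * N = 1 := by
    rw [hc, inv_pow, Real.sq_sqrt hNpos.le, inv_mul_cancel₀ hNne]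
  set u : ℝ → ℂ := fun x ↦ (c : ℂ) * w x with hu
  have hut : IsWeilTest u := hwt.const_mul _
  have hun : ∫ t, ‖u t‖ ^ 2 = (1 : ℝ) := by
    have e : ∀ x, ‖u x‖ ^ 2 = c ^ 2 * ‖w x‖ ^ 2 := fun x ↦ by
      rw [hu, norm_mul, mul_pow, Complex.norm_real, Real.norm_of_nonneg hcpos.le]
    simp_rw [e]
    rw [integral_const_mul]
    exact hc2
  refine ⟨a, le_max_left _ _, u, ⟨hut.memLp_two, fun _ ↦ u, fun _ ↦ ⟨hut,
    tsupport_mul_subset_right.trans hws, fun t ↦ by simp only [hu, hwo, mul_neg], hun⟩, ?_⟩, ?_⟩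
  · simp
  · refine Eventually.of_forall fun t ht ↦ ?_
    have h2 : φ (-t) = 0 := by
      by_contra h
      have b := hφs _ h
      linarith [b.1, ht.1]
    simp only [hu, hw, h2, sub_zero, Complex.mul_im, Complex.ofReal_re, Complex.ofReal_im,
      Complex.mul_re, mul_zero, zero_mul, add_zero, sub_zero]
    exact ⟨trivial, mul_nonneg hcpos.le φ.nonneg⟩

/-- **The sign clause cannot be asked on the WHOLE window.** No odd-sector ground state is real
and `≥ 0` a.e. on `(-a, a)`: oddness a.e. (`IsWeilOddGroundState.ae_neg`) forces `u = 0` a.e. on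
the window, localisation (`ae_eq_zero_of_notMem`) off it, contradicting `‖u‖₂ = 1`. (The
half-window in `X` is not a choice of convenience but the only non-vacuous option.) -/
theorem not_fullWindow_oneSigned :
    ¬ ∃ a : ℝ, ∃ u : ℝ → ℂ, IsWeilOddGroundState a u ∧
      ∀ᵐ t : ℝ, t ∈ Ioo (-a) a → (u t).im = 0 ∧ 0 ≤ (u t).re := by
  rintro ⟨a, u, hu, hsign⟩
  have hodd := hu.ae_neg
  have hsign' : ∀ᵐ t : ℝ, -t ∈ Ioo (-a) a → (u (-t)).im = 0 ∧ 0 ≤ (u (-t)).re :=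
    (Measure.measurePreserving_neg (volume : Measure ℝ)).quasiMeasurePreserving.tendsto_ae.eventually
      hsign
  have hout := hu.ae_eq_zero_of_notMem
  have hend : ∀ᵐ t : ℝ, t ∉ ({a, -a} : Set ℝ) :=
    compl_mem_ae_iff.2 ((Set.toFinite ({a, -a} : Set ℝ)).measure_zero volume)
  have hzero : ∀ᵐ t : ℝ, ‖u t‖ ^ 2 = ‖(0 : ℝ → ℂ) t‖ ^ 2 := by
    filter_upwards [hodd, hsign, hsign', hout, hend] with t ht h1 h2 h3 h4
    simp only [Pi.zero_apply, norm_zero, ne_eq, OfNat.ofNat_ne_zero, not_false_eq_true, zero_pow,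
      pow_eq_zero_iff, norm_eq_zero]
    by_cases hm : t ∈ Ioo (-a) a
    · have hm' : -t ∈ Ioo (-a) a := ⟨by linarith [hm.2], by linarith [hm.1]⟩
      obtain ⟨hi, hr⟩ := h1 hm
      obtain ⟨-, hr'⟩ := h2 hm'
      rw [ht, Complex.neg_re] at hr'
      exact Complex.ext (by rw [Complex.zero_re]; linarith) (by rw [Complex.zero_im]; exact hi)
    · refine h3 fun hI ↦ ?_
      simp only [mem_insert_iff, mem_singleton_iff, not_or] at h4
      exact hm ⟨lt_of_le_of_ne hI.1 (Ne.symm h4.2), lt_of_le_of_ne hI.2 h4.1⟩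
  have h1 : ∫ t, ‖u t‖ ^ 2 = 0 := by
    rw [integral_congr_ae hzero]
    simp
  have h2 := hu.integral_norm_sq
  linarith

/-- Mutation (strengthening): ALL large windows are good. -/
def CruxAllLargeWindows : Prop :=
  ∃ A : ℝ, ∀ a : ℝ, A ≤ a → GoodWindow a

/-- Mutation (strengthening): EVERY positive window is good. -/
def CruxEveryWindow : Prop :=
  ∀ a : ℝ, 0 < a → GoodWindow a

/-- `CruxEveryWindow → CruxAllLargeWindows → X` (trivial). STATUS of the strengthenings: believed
FALSE — one-signedness fails at the windows `a = log q` (the 2001 programme's §10 origin cusp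
`ψ ≈ −Λ(q) q^{-1/2} c₊ ℓ(t)^{3/2}`; confirmed on this hub by prover-1's graded-mesh numerics at
`a = log 2`: bottom odd state `< 0` on `(0, ≈4e-5)`, `L²`-mass `2.6e-12`, hole half-width in `a`
≈ `3–5e-5`). Not refutable in Lean today: it needs the origin asymptotics of the odd Euler–Lagrange
equation (`IsWeilOddGroundState.exists_eulerLagrange` is landed, its boundary analysis is not) AND a
certified non-zero edge value `c₊(log 2)` of the bottom eigenvector (relative size `4.5e-5`, below
any feasible certified Rayleigh–Ritz enclosure at eigenvalue scale `2.6e-10`). The `∃ a ≥ A` form of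
`X` was chosen by the planner precisely to dodge these measure-zero windows. -/
theorem crux_of_allLargeWindows :
    (CruxEveryWindow → CruxAllLargeWindows) ∧ (CruxAllLargeWindows → OddOneSignedWindows) := by
  refine ⟨fun h ↦ ⟨1, fun a ha ↦ h a (by linarith)⟩, fun ⟨A, hA⟩ B ↦ ?_⟩
  exact ⟨max A B, le_max_right _ _, hA _ (le_max_left _ _)⟩

/-! ## 4. The mechanism obstruction (LANDED under `Theorems/OddOneSignedWindows/Negative/`)

`OddFoldPointwise.lean`, `OddFoldIncrements.lean`, `OddFoldRaisesEnergy.lean` (proposals of this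
cycle; namespace `Summit.RiemannHypothesis.Cruxes.OddOneSignedWindows.Negative`):

* `exists_oddFold_weilQuadratic_lt (ha : log 2 / 2 < a)`: explicit `L²`-normalised smooth odd
  window tests `g, h` on `[-a, a]` with `|h| = |g|`, `h` real `≥ 0` on `(0, ∞)`,
  `|h s − h x| ≤ |g s − g x|` (`x, s > 0`), `∫₀^∞ ρ D_t(h) ≤ ∫₀^∞ ρ D_t(g)`, and `Re Q(g) < Re Q(h)`;
* `not_oddFoldContraction (ha : log 2 / 2 < a)`: the odd-sector Beurling–Deny/fold contraction
  property of `Re Q` (the exact hypothesis shape of `setIntegral_weilArchDensity_mul_weilIncrement_fold_le`,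
  which proved `OddArchAnchor`) is FALSE at every window beyond `(log 2)/2`.

Mechanism: `g = g₁ − g₂`, `h = g₁ + g₂`, `gᵢ = φᵢ − φᵢ(−·)`, `φ₁` a bump of width `η` at
`(log 2)/2 − d`, `φ₂ = φ₁(log 2 − ·)`; in `Re Q = P + 𝓔_a − M_a‖·‖²` one gets
`D_t(h) − D_t(g) = 8(φ₁ ∗ φ₂)(t) − 8∫φ₁(x)φ₂(x+t)dx` (`t > 0`), `= 8‖φ₁‖₂² ≥ 8η` at `t = log 2`,
`≥ −16η` on the translation window `t ∈ 2d ± 2η` and `≥ 0` elsewhere; `P(h) − P(g) = −8 s₁ s₂ ≥ −128η²`;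
so `Re Q(h) − Re Q(g) ≥ (16/5)η − (128 + 64ρ(d))η² > 0` for `η ≤ 1/(80 + 40ρ(d))`.
Reading: the prime REFLECTION atoms `+Λ(n) n^{-1/2} δ(x + s − log n)` of the odd block are genuine
positive off-diagonal entries, dominated by nothing structural. Remark for the route's λ-road
(homotopy `Q_λ = Q₀ + λ(Q − Q₀)` from `OddArchAnchor`): in the proof the positive gap comes from
the prime term alone and the losses from pole form / archimedean density are `O(η²)`, so for EVERY
`λ > 0` the same pair (with `η` small in terms of `λ`) breaks fold contraction for `Q_λ` at every
window `a > (log 2)/2` — positivity-improvement of the odd block is lost immediately at `λ = 0⁺`,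
in line with the 2001 diagnosis `λ* → 0` recorded in the route text. The statement below is the
Prop that file refutes, kept here by name for ideators (import the Negative module for the proof). -/

/-- The odd-sector fold-contraction property at window `a` (refuted for every `a > (log 2)/2` by
`Summit.RiemannHypothesis.Cruxes.OddOneSignedWindows.Negative.not_oddFoldContraction`; true in
substance for `a ≤ (log 2)/2`, where `weilPrimeIndex a ⊆ {0, 1}`). -/
def OddFoldContraction (a : ℝ) : Prop :=
  ∀ g h : ℝ → ℂ, IsWeilTest g → IsWeilTest h →
    tsupport g ⊆ Icc (-a) a → tsupport h ⊆ Icc (-a) a →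
    (∀ x, g (-x) = -g x) → (∀ x, h (-x) = -h x) →
    (∀ x s, 0 < x → 0 < s → ‖h s - h x‖ ≤ ‖g s - g x‖) → (∀ x, ‖h x‖ = ‖g x‖) →
    (weilQuadratic h).re ≤ (weilQuadratic g).re

/-- **The fold obstruction, imported** (landed `Negative/OddFoldRaisesEnergy.lean`): the
odd-sector fold-contraction property fails at every window beyond `(log 2)/2`. This confirms and
quantifies ideator-1's informal dead-lever note (B-atoms / B-vacuous-rearrangement) and closes the
purely structural (Markov / Perron–Frobenius / Jentzsch / rearrangement) road to the crux. -/
theorem not_oddFoldContraction {a : ℝ} (ha : Real.log 2 / 2 < a) : ¬ OddFoldContraction a :=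
  Summit.RiemannHypothesis.Cruxes.OddOneSignedWindows.Negative.not_oddFoldContraction ha

/-- Hence the contraction property holds at NO window `a > (log 2)/2`, however large. -/
theorem oddFoldContraction_imp_le {a : ℝ} (h : OddFoldContraction a) : a ≤ Real.log 2 / 2 :=
  not_lt.1 fun ha ↦ not_oddFoldContraction ha h

/-- Monotonicity in the window: the contraction property only gets harder as `a` grows (so its
failure at `(log 2)/2 < a₀` propagates to every `a ≥ a₀`; the Negative file proves failure directly
at each `a > (log 2)/2`). -/
theorem oddFoldContraction_anti {a b : ℝ} (hab : a ≤ b) (h : OddFoldContraction b) :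
    OddFoldContraction a :=
  fun g k hg hk hsg hsk hgo hko hd hn ↦
    h g k hg hk (hsg.trans (Icc_subset_Icc (by linarith) hab)) (hsk.trans (Icc_subset_Icc (by linarith) hab))
      hgo hko hd hn

end Summit.RiemannHypothesis.RiemannHypothesis.Cruxes.OddOneSignedWindows.Disproof

end
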